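import Mathlib
import HarnessLib
import HarnessLib.Audit.Tags

/-!
# HodgeLocusCensusNakayamaCertificate — the tangent-cone ('Nakayama') certificate of a FAT POINT

HONEST FRAMING (verbatim, pub-hlocus cell): certified instances and evidence bearing on the general
Hodge conjecture; no claim.

DICTIONARY (cell files `CENSUS-SUMMARY.md` §2 rows O6–O8, engine A `tilt.py` 'HS = [1,2,…,L,L]',
engine B `fmexact`; referee R75(c): 'a Nakayama certificate m^N ⊂ I + m^{N+1} gives m^N ⊂ I, i.e. the
slice is a 0-dimensional germ').  `R` = the (Noetherian, local) ring of the ambient slice germ, `𝔪` its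
maximal ideal, `I ⊆ R` the ideal of the Hodge locus in the slice.  The engines compute the Hilbert
function of the TANGENT CONE of `R ⧸ I` degree by degree; 'the Hilbert function vanishes in degree `N`'
is the ideal-theoretic statement `𝔪^N ≤ I ⊔ 𝔪^(N+1)` (every monomial of degree `N` is a leading form
of an element of `I` up to higher order).

What the kernel checks (Mathlib only, no definitions):
* `maximalIdeal_pow_le_of_certificate` — NAKAYAMA STEP: `𝔪^N ≤ I ⊔ 𝔪^(N+1)` ⇒ `𝔪^N ≤ I`
  (Mathlib `Submodule.le_of_le_smul_of_le_jacobson_bot`, `𝔪 ≤ jacobson ⊥` in a local ring, `𝔪^N`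
  finitely generated by Noetherianity).
* `isArtinianRing_quotient_of_maximalIdeal_pow_le` — `𝔪^N ≤ I`, `I ≠ ⊤` ⇒ `R ⧸ I` is an ARTINIAN local
  ring (the slice germ is a fat point; this is the hypothesis `[IsArtinianRing (R ⧸ Ideal.span ↑s)]` of
  `HodgeLocusCensusSliceDimension.ringKrullDim_le_card_of_isArtinianRing_quotient`; converse direction
  of Mathlib `IsLocalRing.exists_maximalIdeal_pow_le_of_isArtinianRing_quotient`).
* `isArtinianRing_quotient_of_certificate` — the two combined: the engines' degree-`N` certificate ⇒
  the slice germ is Artinian.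
NOT formalised: the finite computations producing the certificates, the value of the length, and all
Hodge theory.
-/

namespace Summit.HodgeConjecture.HodgeConjecture.HodgeLocus.Census

open IsLocalRing

variable {R : Type*} [CommRing R] [IsNoetherianRing R] [IsLocalRing R]

/-- **Nakayama step of the fat-point certificate.**  If the degree-`N` piece of the tangent cone of
`R ⧸ I` vanishes, i.e. `𝔪^N ≤ I ⊔ 𝔪^(N+1)`, then `𝔪^N ≤ I`. -/
theorem maximalIdeal_pow_le_of_certificate (I : Ideal R) (N : ℕ)
    (h : maximalIdeal R ^ N ≤ I ⊔ maximalIdeal R ^ (N + 1)) : maximalIdeal R ^ N ≤ I := by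
  have hfg : (maximalIdeal R ^ N).FG := IsNoetherian.noetherian _
  have hjac : maximalIdeal R ≤ (⊥ : Ideal R).jacobson := maximalIdeal_le_jacobson ⊥
  refine Submodule.le_of_le_smul_of_le_jacobson_bot hfg hjac ?_
  rwa [Ideal.smul_eq_mul, ← pow_succ']

/-- `𝔪^N ≤ I` with `I` proper ⇒ the quotient `R ⧸ I` is an Artinian (local, Noetherian) ring. -/
theorem isArtinianRing_quotient_of_maximalIdeal_pow_le {I : Ideal R} (hI : I ≠ ⊤) {N : ℕ}
    (hN : maximalIdeal R ^ N ≤ I) : IsArtinianRing (R ⧸ I) := by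
  have : Nontrivial (R ⧸ I) := Ideal.Quotient.nontrivial_iff.mpr hI
  have : IsLocalRing (R ⧸ I) :=
    IsLocalRing.of_surjective' (Ideal.Quotient.mk I) Ideal.Quotient.mk_surjective
  rw [isArtinianRing_iff_isNilpotent_maximalIdeal]
  refine ⟨N, ?_⟩
  have hmap : (maximalIdeal R).map (Ideal.Quotient.mk I) = maximalIdeal (R ⧸ I) :=
    map_maximalIdeal_of_surjective (Ideal.Quotient.mk I) Ideal.Quotient.mk_surjective
  rw [← hmap, ← Ideal.map_pow, Ideal.zero_eq_bot, Ideal.map_eq_bot_iff_le_ker, Ideal.mk_ker]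
  exact hN

/-- **The engines' certificate ⇒ fat point.**  `𝔪^N ≤ I ⊔ 𝔪^(N+1)` (degree-`N` piece of the tangent
cone vanishes) and `I ≠ ⊤` ⇒ `R ⧸ I` is Artinian. -/
theorem isArtinianRing_quotient_of_certificate {I : Ideal R} (hI : I ≠ ⊤) (N : ℕ)
    (h : maximalIdeal R ^ N ≤ I ⊔ maximalIdeal R ^ (N + 1)) : IsArtinianRing (R ⧸ I) :=
  isArtinianRing_quotient_of_maximalIdeal_pow_le hI (maximalIdeal_pow_le_of_certificate I N h)

end Summit.HodgeConjecture.HodgeConjecture.HodgeLocus.Census
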